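import Literature.Barriers.CriticalPhenomena.PlaquetteWalkAngleLimitPhase
import HarnessLib

/-!
# Barrier catalogue (SAWScalingLimit): the quarter turns of a WOUND excursion are rigid — `±4` or `±5`, read off the three sides
(«EXCURSION TURNING»)

`Z → ∞` limit model of the printed Yang–Baxter weights [GlazmanManolescu2019, §1, eq. (1)]; the «RECTANGLE COEFFICIENT» line
(`PlaquetteWalkAngleLimitPhase`, `PlaquetteWalkAngleLimitRowCoherence`, `PlaquetteWalkHoleRootWoundCost`, …). The tree's WINDING LAW
(`ΩG.WE_sub_excursionWinding_eq_two_mul_AJ_root`: `WE(θ) − excursionWinding(θ; z₀, z₁, z₂) = 2·A_J(mid a)` for every class-`B2a` walk at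
any rooted rhombus of any domain) and its SIGN RULE (`ΩG.AJ_root_eq_chordSign_of_ne_zero`: a wound excursion winds `2π·chordSign(z₀; z₁, z₂)`
about the root) are evaluated here at the right angle `θ = π/2`, where the rotation of every arc is `π/2` times its signed quarter turn:

* `woundTurns z₀ z₁ z₂ ∈ {±4, ±5}` — THE TABLE: `(2/π)·excursionWinding(π/2; z₀, z₁, z₂) + 8·chordSign(z₀; z₁, z₂)` for distinct sides
  (`woundTurns_eq`, `woundTurns_natAbs`; `|woundTurns| = 4` exactly when the return side is opposite to the exit side);
* ★★★ `ΩG.excursion_quarterTurns_of_wound`: for a WOUND class-`B2a` walk (`A_J(mid a) ≠ 0`) the signed quarter turns of the arcs after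
  the first arc in `r` sum to `woundTurns z₀ z₁ z₂` — e.g. `+5` for (`W`, `E`, `S`): a walk crossing `r` straight from `W` and returning
  to its `S` side winds FIVE left quarter turns net (the unwound excursion of the same sides winds `−3`);
* ★★ `ΩG.four_le_excursion_turns_of_wound`: hence the excursion of a wound walk has at least FOUR turning (non-straight) arcs, and at
  least `|woundTurns|` of them (`ΩG.woundTurns_natAbs_le_excursion_turns`); ★★ `ΩG.excursion_chirality_of_tight`: when it has EXACTLY
  `|woundTurns|` of them, all its turns have one chirality (the sign of `woundTurns`);
* bookkeeping: `YBWalk.qTurnOf_getElem` (the quarter turn of the `m`-th arc is `qTurn (sIn m) (sOut m)`),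
  `qTurn_ne_zero_iff` (non-zero quarter turn ⇔ not straight), `qTurn_eq_one_iff` / `qTurn_eq_neg_one_iff` (left = `HL ∪ VL`, right =
  `HR ∪ VR`), `ΩG.WE_pi_div_two_eq`; private list plumbing (`natAbs_sum_le_countP`, `forall_eq_of_natAbs_sum_eq_length`,
  `sum_filter_ne_zero`).

Use (venture lane «pcv-sawmu», b-engine-1 g25; DESIGN-next-g24 §2bis (R4) «orientation»): with only `4 + slotDeg` isolated turns at limit
cost `5` (`PlaquetteWalkAngleLimitRowCoherence.isolated_eq_of_cost_five`) the table forces the chirality of every turn of the principal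
cost-`5` members, hence their phase classes. General (any domain, any root); elementary given the tree's winding law and sign rule.
[GlazmanManolescu2019 Lemma 2.1 («in the form given in [Gl]»); Glazman 2015 Lemma 3.1 (proof, pp. 6–7); Hopf 1935 (Umlaufsatz)]
-/

noncomputable section

namespace Literature.Probability.RandomPlanarGeometry.SAW.YangBaxter

open Real
open Literature.Barriers.CriticalPhenomena.PlaquetteWalk

open private arcTurnOf_pi_div_two from Literature.Probability.RandomPlanarGeometry.YangBaxterSAWGeneralDomain

/-! ## The table of wound quarter turns -/

/-- ★ **THE WOUND QUARTER TURNS** of an excursion with first side `z₀`, exit side `z₁` and return side `z₂` (pairwise distinct; junk `0`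
otherwise): `(2/π)·excursionWinding(π/2; z₀, z₁, z₂) + 8·chordSign(z₀; z₁, z₂)` — the net number of left quarter turns of a WOUND excursion
with these sides (`ΩG.excursion_quarterTurns_of_wound`). Values `±5` when the return side is adjacent to the exit side, `±4` when it is
opposite. [cite: GlazmanManolescu2019, Lemma 2.1 (statement, «in the form given in [Gl]»)] [cite: Glazman2015WeightedSAW, Lemma 3.1 (proof, pp. 6–7)] -/
def woundTurns : Side → Side → Side → ℤ
  | .E, .N, .S => -4
  | .E, .N, .W => -5
  | .E, .S, .N => 4
  | .E, .S, .W => 5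
  | .E, .W, .N => 5
  | .E, .W, .S => -5
  | .N, .E, .S => 5
  | .N, .E, .W => 4
  | .N, .S, .E => -5
  | .N, .S, .W => 5
  | .N, .W, .E => -4
  | .N, .W, .S => -5
  | .S, .E, .N => -5
  | .S, .E, .W => -4
  | .S, .N, .E => 5
  | .S, .N, .W => -5
  | .S, .W, .E => 4
  | .S, .W, .N => 5
  | .W, .E, .N => -5
  | .W, .E, .S => 5
  | .W, .N, .E => 5
  | .W, .N, .S => 4
  | .W, .S, .E => -5
  | .W, .S, .N => -4
  | _, _, _ => 0

/-- The twenty-four chord signs (`YangBaxterSAWExcursionJordan.chordSign_table` lists twelve; the other twelve are their swaps).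
[cite: GlazmanManolescu2019, Lemma 2.1 (statement, «in the form given in [Gl]»)] [cite: Glazman2015WeightedSAW, Lemma 3.1 (proof, pp. 6–7)] -/
theorem chordSign_values :
    chordSign .W .E .S = 1 ∧ chordSign .W .E .N = -1 ∧ chordSign .W .S .N = -1 ∧ chordSign .W .N .S = 1 ∧
    chordSign .W .S .E = -1 ∧ chordSign .W .N .E = 1 ∧
    chordSign .E .W .S = -1 ∧ chordSign .E .W .N = 1 ∧ chordSign .E .S .N = 1 ∧ chordSign .E .N .S = -1 ∧
    chordSign .E .S .W = 1 ∧ chordSign .E .N .W = -1 ∧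
    chordSign .S .W .E = 1 ∧ chordSign .S .W .N = 1 ∧ chordSign .S .E .N = -1 ∧ chordSign .S .N .E = 1 ∧
    chordSign .S .E .W = -1 ∧ chordSign .S .N .W = -1 ∧
    chordSign .N .W .E = -1 ∧ chordSign .N .W .S = -1 ∧ chordSign .N .E .S = 1 ∧ chordSign .N .S .E = -1 ∧
    chordSign .N .E .W = 1 ∧ chordSign .N .S .W = 1 := by
  decide

/-- ★ **THE TABLE IS THE WINDING LAW AT THE RIGHT ANGLE**: for pairwise distinct sides,
`(π/2)·woundTurns z₀ z₁ z₂ = excursionWinding(π/2; z₀, z₁, z₂) + 4π·chordSign(z₀; z₁, z₂)`.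
[cite: GlazmanManolescu2019, Lemma 2.1 (statement, «in the form given in [Gl]»)] [cite: Glazman2015WeightedSAW, Lemma 3.1 (proof, pp. 6–7)] -/
theorem woundTurns_eq {z₀ z₁ z₂ : Side} (h01 : z₀ ≠ z₁) (h02 : z₀ ≠ z₂) (h12 : z₁ ≠ z₂) :
    π / 2 * (woundTurns z₀ z₁ z₂ : ℝ) = excursionWinding (π / 2) z₀ z₁ z₂ + 4 * π * (chordSign z₀ z₁ z₂ : ℝ) := by
  obtain ⟨c1, c2, c3, c4, c5, c6, c7, c8, c9, c10, c11, c12, c13, c14, c15, c16, c17, c18, c19, c20, c21, c22, c23, c24⟩ :=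
    chordSign_values
  cases z₀ <;> cases z₁ <;> cases z₂ <;>
    first
    | exact absurd rfl h01
    | exact absurd rfl h02
    | exact absurd rfl h12
    | (simp only [woundTurns, excursionWinding, c1, c2, c3, c4, c5, c6, c7, c8, c9, c10, c11, c12, c13, c14, c15, c16, c17, c18,
        c19, c20, c21, c22, c23, c24]; push_cast; ring)

/-- `|woundTurns| ∈ {4, 5}` for pairwise distinct sides. [cite: GlazmanManolescu2019, Lemma 2.1 (statement, «in the form given in [Gl]»)] -/
theorem woundTurns_natAbs {z₀ z₁ z₂ : Side} (h01 : z₀ ≠ z₁) (h02 : z₀ ≠ z₂) (h12 : z₁ ≠ z₂) :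
    (woundTurns z₀ z₁ z₂).natAbs = 4 ∨ (woundTurns z₀ z₁ z₂).natAbs = 5 := by
  revert h01 h02 h12; revert z₀ z₁ z₂; decide

/-- `|woundTurns| = 4` exactly when the return side is OPPOSITE to the exit side (else `5`).
[cite: GlazmanManolescu2019, Lemma 2.1 (statement, «in the form given in [Gl]»)] -/
theorem woundTurns_natAbs_eq_four_iff {z₀ z₁ z₂ : Side} (h01 : z₀ ≠ z₁) (h02 : z₀ ≠ z₂) (h12 : z₁ ≠ z₂) :
    (woundTurns z₀ z₁ z₂).natAbs = 4 ↔ z₂ = z₁.opp := by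
  revert h01 h02 h12; revert z₀ z₁ z₂; decide

/-- `4 ≤ |woundTurns|` for pairwise distinct sides. [cite: GlazmanManolescu2019, Lemma 2.1 (statement, «in the form given in [Gl]»)] -/
theorem four_le_woundTurns_natAbs {z₀ z₁ z₂ : Side} (h01 : z₀ ≠ z₁) (h02 : z₀ ≠ z₂) (h12 : z₁ ≠ z₂) :
    4 ≤ (woundTurns z₀ z₁ z₂).natAbs := by
  rcases woundTurns_natAbs h01 h02 h12 with h | h <;> omega

/-! ## Quarter turns of arcs -/

/-- A quarter turn is `0`, `1` or `−1`. [cite: GlazmanManolescu2019, §2.1 (lane plumbing)] -/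
theorem qTurn_trichotomy (s u : Side) : qTurn s u = 0 ∨ qTurn s u = 1 ∨ qTurn s u = -1 := by
  cases s <;> cases u <;> decide

/-- `|qTurn| ≤ 1`. [cite: GlazmanManolescu2019, §2.1 (lane plumbing)] -/
theorem qTurn_natAbs_le (s u : Side) : (qTurn s u).natAbs ≤ 1 := by
  cases s <;> cases u <;> decide

/-- Between distinct sides, the quarter turn vanishes exactly for a straight arc. [cite: GlazmanManolescu2019, §1, Fig. 1; §2.1] -/
theorem qTurn_ne_zero_iff {s u : Side} (hsu : s ≠ u) : qTurn s u ≠ 0 ↔ arcKind s u ≠ .straight := by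
  revert hsu; cases s <;> cases u <;> decide

/-- A left quarter turn entered horizontally is an `HL` arc, entered vertically a `VL` arc (and conversely).
[cite: GlazmanManolescu2019, §1, Fig. 1; §2.1] -/
theorem qTurn_eq_one_iff (s u : Side) : qTurn s u = 1 ↔ (isHL (s, u) = true ∨ isVL (s, u) = true) := by
  cases s <;> cases u <;> decide

/-- A right quarter turn is an `HR` or a `VR` arc (and conversely). [cite: GlazmanManolescu2019, §1, Fig. 1; §2.1] -/
theorem qTurn_eq_neg_one_iff (s u : Side) : qTurn s u = -1 ↔ (isHR (s, u) = true ∨ isVR (s, u) = true) := by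
  cases s <;> cases u <;> decide

/-- `|qTurnOf p| ≤ 1` for every pair of mid-edges. [cite: GlazmanManolescu2019, §2.1 (lane plumbing)] -/
theorem qTurnOf_natAbs_le (p : MidEdge × MidEdge) : (qTurnOf p).natAbs ≤ 1 := by
  rcases arc_data p with ⟨-, -, h⟩ | ⟨s, t, -, -, -, h⟩
  · rw [h]; simp
  · rw [h]; exact qTurn_natAbs_le s t

/-- A sum of integers of absolute value `≤ 1` is, in absolute value, at most the number of its non-zero terms. [folklore] (lane plumbing) -/
private theorem natAbs_sum_le_countP (l : List ℤ) (h : ∀ x ∈ l, x.natAbs ≤ 1) : l.sum.natAbs ≤ l.countP (fun x => x ≠ 0) := by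
  induction l with
  | nil => simp
  | cons x l ih =>
    rw [List.sum_cons, List.countP_cons]
    have hx := h x (by simp)
    have hl := ih (fun y hy => h y (by simp [hy]))
    have htri := Int.natAbs_add_le x l.sum
    by_cases h0 : x = 0
    · subst h0; simpa using hl
    · have : decide (x ≠ 0) = true := by simpa using h0
      rw [this]; simp only [ite_true]; omega

/-- A list of integers of absolute value `≤ 1` whose sum has absolute value EQUAL to the length consists of `1`s only (sum `= length`)
or of `−1`s only (sum `= −length`). [folklore] (lane plumbing) -/
private theorem forall_eq_of_natAbs_sum_eq_length (l : List ℤ) (h : ∀ x ∈ l, x.natAbs ≤ 1) (hs : l.sum.natAbs = l.length) :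
    (l.sum = l.length ∧ ∀ x ∈ l, x = 1) ∨ (l.sum = -(l.length : ℤ) ∧ ∀ x ∈ l, x = -1) := by
  induction l with
  | nil => simp
  | cons x l ih =>
    rw [List.sum_cons, List.length_cons] at hs
    have hx := h x (by simp)
    have hl' : ∀ y ∈ l, y.natAbs ≤ 1 := fun y hy => h y (by simp [hy])
    have hle := natAbs_sum_le_countP l hl'
    have hcl : l.countP (fun x => x ≠ 0) ≤ l.length := List.countP_le_length
    have htri := Int.natAbs_add_le x l.sum
    have hsl : l.sum.natAbs = l.length := by omega
    rcases ih hl' hsl with ⟨hsum, hall⟩ | ⟨hsum, hall⟩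
    · by_cases hl0 : l.length = 0
      · -- singleton: `x = ±1`
        have hln : l = [] := List.eq_nil_of_length_eq_zero hl0
        subst hln
        simp only [List.sum_nil, add_zero, List.length_nil] at hs
        rcases Int.natAbs_eq_iff.1 (show x.natAbs = 1 by simpa using hs) with e | e
        · left; simp [e]
        · right; simp [e]
      · left
        have hx1 : x = 1 := by omega
        refine ⟨by rw [List.sum_cons, List.length_cons, hx1, hsum]; push_cast; ring, ?_⟩
        intro y hy
        rcases List.mem_cons.1 hy with rfl | hy
        · exact hx1
        · exact hall y hy
    · by_cases hl0 : l.length = 0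
      · have hln : l = [] := List.eq_nil_of_length_eq_zero hl0
        subst hln
        simp only [List.sum_nil, add_zero, List.length_nil] at hs
        rcases Int.natAbs_eq_iff.1 (show x.natAbs = 1 by simpa using hs) with e | e
        · left; simp [e]
        · right; simp [e]
      · right
        have hx1 : x = -1 := by omega
        refine ⟨by rw [List.sum_cons, List.length_cons, hx1, hsum]; push_cast; ring, ?_⟩
        intro y hy
        rcases List.mem_cons.1 hy with rfl | hy
        · exact hx1
        · exact hall y hy

namespace YBWalk

variable {D : Set Face} {a z : MidEdge} (γ : YBWalk D a z)

/-- ★ The quarter turn of the `m`-th arc is `qTurn (sIn m) (sOut m)`. [cite: GlazmanManolescu2019, §2.1 (the winding of a walk); lane plumbing] -/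
theorem qTurnOf_getElem {m : ℕ} (hm : m < γ.arcs.length) : qTurnOf γ.arcs[m] = qTurn (γ.sIn m) (γ.sOut m) := by
  obtain ⟨h1, h2, h3⟩ := side_sIn hm
  rw [γ.getElem_arcs hm, ← h1, ← h2]
  simp [qTurnOf, arcFace_side_side _ _ _ h3, Face.sideOf_side]

/-- The `m`-th arc turns (non-zero quarter turn) iff it is not straight. [cite: GlazmanManolescu2019, §1, Fig. 1; §2.1] -/
theorem qTurnOf_getElem_ne_zero_iff {m : ℕ} (hm : m < γ.arcs.length) :
    qTurnOf γ.arcs[m] ≠ 0 ↔ arcKind (γ.sIn m) (γ.sOut m) ≠ .straight := by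
  rw [γ.qTurnOf_getElem hm]
  exact qTurn_ne_zero_iff (γ.sIn_ne_sOut hm)

end YBWalk

/-! ## The excursion of a wound walk turns `woundTurns z₀ z₁ z₂` quarter turns -/

namespace ΩG

variable {D : Set Face} {a : MidEdge} {r : Face} {ω : ΩG D a r}

/-- The right-angle winding of the excursion is `π/2` times the quarter turns of its arcs. [cite: GlazmanManolescu2019, §2.1 (the winding); lane plumbing] -/
theorem WE_pi_div_two_eq (ω : ΩG D a r) :
    ω.WE (fun _ => π / 2) = π / 2 * ((((ω.2.arcs.drop (ω.2.firstHitG + 1)).map qTurnOf).sum : ℤ) : ℝ) := by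
  unfold ΩG.WE
  rw [Int.cast_list_sum, List.map_map, ← List.sum_map_mul_left]
  congr 1
  refine List.map_congr_left fun p _ => ?_
  simp [Function.comp, arcTurnOf_pi_div_two]

/-- ★★★ **THE QUARTER TURNS OF A WOUND EXCURSION ARE RIGID.** For a class-`B2a` walk `ω` at a rooted rhombus `r` of any domain whose
excursion polygon winds around the midpoint of the root (`A_J(mid a) ≠ 0`), the signed quarter turns of the arcs after the first arc in
`r` sum to `woundTurns z₀ z₁ z₂` (`z₀` the first side, `z₁` the exit side, `z₂ = ω.1` the return side): the winding law
`WE − excursionWinding = 2A_J` and the sign rule `A_J = 2π·chordSign` at the right angle. [cite: GlazmanManolescu2019, Lemma 2.1 (statement, «in the form given in [Gl]»)]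
[cite: Glazman2015WeightedSAW, Lemma 3.1 (proof, pp. 6–7)] [cite: Hopf1935, Nr. 2 (Umlaufsatz, p. 53)] -/
theorem excursion_quarterTurns_of_wound (hr : RootedFace D a r) (h : ω.IsB2a) (hA : ω.AJ hr h (toC (midPt a)) ≠ 0) :
    ((ω.2.arcs.drop (ω.2.firstHitG + 1)).map qTurnOf).sum = woundTurns ω.2.firstSideG (ω.z1 hr h) ω.1 := by
  obtain ⟨h01, h02, h12⟩ := ω.firstSide_exit_return_distinct hr h
  have e1 := WE_sub_excursionWinding_eq_two_mul_AJ_root hr h (π / 2)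
  have e2 := AJ_root_eq_chordSign_of_ne_zero (hr := hr) h hA
  have e3 := WE_pi_div_two_eq ω
  have e4 := woundTurns_eq h01 h02 h12
  have key : (π / 2) * ((((ω.2.arcs.drop (ω.2.firstHitG + 1)).map qTurnOf).sum : ℤ) : ℝ) =
      (π / 2) * (woundTurns ω.2.firstSideG (ω.z1 hr h) ω.1 : ℝ) := by
    rw [← e3, e4]
    rw [e2] at e1
    linarith
  have := mul_left_cancel₀ (by positivity : (π / 2 : ℝ) ≠ 0) key
  exact_mod_cast this

/-- ★★ **A WOUND EXCURSION TURNS AT LEAST `|woundTurns|` TIMES**: the number of non-straight arcs after the first arc in `r` is at least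
`|woundTurns z₀ z₁ z₂| ≥ 4`. [cite: GlazmanManolescu2019, Lemma 2.1 (statement, «in the form given in [Gl]»)] [cite: Glazman2015WeightedSAW, Lemma 3.1 (proof, pp. 6–7)] -/
theorem woundTurns_natAbs_le_excursion_turns (hr : RootedFace D a r) (h : ω.IsB2a) (hA : ω.AJ hr h (toC (midPt a)) ≠ 0) :
    (woundTurns ω.2.firstSideG (ω.z1 hr h) ω.1).natAbs ≤ (ω.2.arcs.drop (ω.2.firstHitG + 1)).countP (fun p => qTurnOf p ≠ 0) := by
  rw [← excursion_quarterTurns_of_wound hr h hA]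
  have := natAbs_sum_le_countP ((ω.2.arcs.drop (ω.2.firstHitG + 1)).map qTurnOf)
    (fun x hx => by obtain ⟨p, -, rfl⟩ := List.mem_map.1 hx; exact qTurnOf_natAbs_le p)
  rw [List.countP_map] at this
  exact this

/-- ★★ **AT LEAST FOUR TURNING ARCS IN A WOUND EXCURSION.** [cite: GlazmanManolescu2019, Lemma 2.1 (statement, «in the form given in [Gl]»)]
[cite: Glazman2015WeightedSAW, Lemma 3.1 (proof, pp. 6–7)] -/
theorem four_le_excursion_turns_of_wound (hr : RootedFace D a r) (h : ω.IsB2a) (hA : ω.AJ hr h (toC (midPt a)) ≠ 0) :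
    4 ≤ (ω.2.arcs.drop (ω.2.firstHitG + 1)).countP (fun p => qTurnOf p ≠ 0) := by
  obtain ⟨h01, h02, h12⟩ := ω.firstSide_exit_return_distinct hr h
  exact (four_le_woundTurns_natAbs h01 h02 h12).trans (woundTurns_natAbs_le_excursion_turns hr h hA)

/-- The sum of a list equals the sum of its non-zero terms. [folklore] (lane plumbing) -/
private theorem sum_filter_ne_zero (L : List ℤ) : (L.filter (fun x => x ≠ 0)).sum = L.sum := by
  induction L with
  | nil => simp
  | cons x l ih =>
    by_cases hx : x = 0
    · subst hx
      rw [List.filter_cons_of_neg (by simp), List.sum_cons, zero_add]; exact ih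
    · rw [List.filter_cons_of_pos (by simpa using hx), List.sum_cons, List.sum_cons, ih]

/-- ★★ **ALL EXCURSION TURNS HAVE ONE CHIRALITY WHEN THERE IS NO SLACK**: if the excursion of a wound class-`B2a` walk has EXACTLY
`|woundTurns z₀ z₁ z₂|` turning arcs, then every turning arc after the first arc in `r` turns the same way — all quarter turns `+1`
(`woundTurns > 0`) or all `−1` (`woundTurns < 0`). [cite: GlazmanManolescu2019, Lemma 2.1 (statement, «in the form given in [Gl]»)]
[cite: Glazman2015WeightedSAW, Lemma 3.1 (proof, pp. 6–7)] -/
theorem excursion_chirality_of_tight (hr : RootedFace D a r) (h : ω.IsB2a) (hA : ω.AJ hr h (toC (midPt a)) ≠ 0)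
    (ht : (ω.2.arcs.drop (ω.2.firstHitG + 1)).countP (fun p => qTurnOf p ≠ 0) =
      (woundTurns ω.2.firstSideG (ω.z1 hr h) ω.1).natAbs) :
    (0 < woundTurns ω.2.firstSideG (ω.z1 hr h) ω.1 ∧ ∀ p ∈ ω.2.arcs.drop (ω.2.firstHitG + 1), qTurnOf p ≠ 0 → qTurnOf p = 1) ∨
      (woundTurns ω.2.firstSideG (ω.z1 hr h) ω.1 < 0 ∧ ∀ p ∈ ω.2.arcs.drop (ω.2.firstHitG + 1), qTurnOf p ≠ 0 → qTurnOf p = -1) := by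
  obtain ⟨h01, h02, h12⟩ := ω.firstSide_exit_return_distinct hr h
  have h4 := four_le_woundTurns_natAbs h01 h02 h12
  have hsum : ((ω.2.arcs.drop (ω.2.firstHitG + 1)).map qTurnOf).sum = woundTurns ω.2.firstSideG (ω.z1 hr h) ω.1 :=
    excursion_quarterTurns_of_wound hr h hA
  set L := (ω.2.arcs.drop (ω.2.firstHitG + 1)).map qTurnOf with hL
  have hsum' := sum_filter_ne_zero L
  have hlen : (L.filter (fun x => x ≠ 0)).length = (woundTurns ω.2.firstSideG (ω.z1 hr h) ω.1).natAbs := by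
    rw [← List.countP_eq_length_filter, ← ht, hL, List.countP_map]; rfl
  have hb : ∀ x ∈ L.filter (fun x => x ≠ 0), x.natAbs ≤ 1 := by
    intro x hx
    obtain ⟨p, -, rfl⟩ := List.mem_map.1 (List.mem_of_mem_filter hx)
    exact qTurnOf_natAbs_le p
  have hmem : ∀ p ∈ ω.2.arcs.drop (ω.2.firstHitG + 1), qTurnOf p ≠ 0 → qTurnOf p ∈ L.filter (fun x => x ≠ 0) := by
    intro p hp hq
    rw [List.mem_filter]
    exact ⟨List.mem_map.2 ⟨p, hp, rfl⟩, by simpa using hq⟩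
  have hlen' : (L.filter (fun x => x ≠ 0)).sum.natAbs = (L.filter (fun x => x ≠ 0)).length := by rw [hsum', hsum, hlen]
  rcases forall_eq_of_natAbs_sum_eq_length _ hb hlen' with ⟨hs, hall⟩ | ⟨hs, hall⟩
  · left
    refine ⟨?_, fun p hp hq => hall _ (hmem p hp hq)⟩
    rw [← hsum, ← hsum', hs, hlen]; have := h4; omega
  · right
    refine ⟨?_, fun p hp hq => hall _ (hmem p hp hq)⟩
    rw [← hsum, ← hsum', hs, hlen]; have := h4; omega

end ΩG

end Literature.Probability.RandomPlanarGeometry.SAW.YangBaxter
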